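import Summits.QuantumFields.YangMills.Theorems.UnitScaleTiltProp7CentreHarmonicInterpolantFlat
import HarnessLib

/-!
# Route `UnitScaleTilt`, crux K1 «MinimiserStabilityRegPr» (stmt-QuantumFields-19200), route-R E′ path (α′), residue (hK), step (A1): THE PINNED BIHARMONIC GREEN MATRIX EXISTS (flat B5
# model) — a matrix `G` with `G(x, y) = 0` at every centre `y` and `e(x) = Σ_z G(x,z)·(Δ²e)(z)` for every `e` vanishing on the centres: the displayed rows `hGrep`∕`hG0` of
# ✓ `…CentreHarmonicInterpKernel.norm_grad_interp_error_le`, discharged in the B5 carrier from ✓ `…CentreHarmonicInterpolantFlat` (interpolant) and `Δ⁻²` (✓ `B5LaplaceInverse`)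

Cell `ym3-torus`, D-0154 (3c) twin-width seat `ym-routeR-w3` (gen 5); ★p1 g14 standing PASS-at-dry-run 18:44:59Z; LOCATE 19200 evidence #53 §9 (A1).  THEOREMS ONLY (0 `def`, 0 `sorry`);
`--supports stmt-QuantumFields-19200`, count-neutral.  YM₃ on T³ is a ladder rung (R3), not the Clay problem; nothing here claims the stub, the crux, d = 4 or the gap.

CONSTRUCTION (LOCATE §9).  Fix a centre `y₀ = up y₀'`.  For each site `x`: `v_x := Δ⁻²(δ_x − δ_{y₀})` (mean-zero source, so `Δ²v_x = δ_x − δ_{y₀}` exactly) and `u_x :=` the pinned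
biharmonic interpolant of `v_x|_centres` (✓ `exists_pinned_biharmonic_interpolant`: `u_x ∘ up = v_x ∘ up`, `Δ²u_x = 0` off the centres); `G(x,·) := v_x − u_x`.  Then `G(x, up y) = 0`,
and for `e` vanishing on the centres `Σ_z G(x,z)(Δ²e)(z) = Σ_z (Δ²G(x,·))(z)·e(z)` (Δ symmetric, twice) `= Σ_z (δ_x − δ_{y₀} − Δ²u_x)(z)e(z) = e(x)` (the last two are supported on centres).

WHAT IS PROVED (ns `…Theorems.Prop7PinnedBiharmonicGreenMatrix`; `Tor (fine n M)`, η-units `Δ = LapS … n`, `n ≥ 1`).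
* §1 `sum_mul_LapS_mulVec_comm` (`Σ_z a(z)(Δe)(z) = Σ_z (Δa)(z)e(z)`), `sum_mul_LapS_LapS_comm` (the same for `Δ²`), `LapS_LapS_LapSinv_LapSinv_of_orth` (`Δ²Δ⁻²f = f` for `Σf = 0`),
  `sum_delta_sub_delta` (`Σ(δ_x − δ_{y₀}) = 0`).
* §2 ★★★ `exists_pinned_biharmonic_green (hn : 1 ≤ n) (y₀' : Tor M) : ∃ G : Tor (fine n M) → Tor (fine n M) → ℂ, (∀ x y, G x (up y) = 0) ∧ ∀ e, (∀ y, e (up y) = 0) → ∀ x,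
  e x = Σ_z G x z * (Δ(Δe))(z)`.
HONEST SCOPE.  Flat, scalar, B5 carrier; reading it on `Site (F.P K) 0` with `laplace 1` and `C = range (embIter k)` is px17's ✓ `…CentreHarmonicDivDictionary` bookkeeping (`EK`,
`LapS_one_mulVec_transl`, `LapS_natCast_mulVec`), i.e. (A)'s §0; the kernel bound (hK) itself is NOT here.

References: T. Bałaban, CMP 95 (1984) 17–40 [Balaban1984PropagatorsI] (Sect. C p.22, (1.21) p.21); CMP 99 (1985) 75–102 [Balaban1985RegularSpaces] ((1.14) p.78).
-/

set_option autoImplicit false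

noncomputable section

open scoped BigOperators Matrix ComplexConjugate
open Finset Complex Matrix

namespace Summit.QuantumFields.YangMills.Theorems.Prop7PinnedBiharmonicGreenMatrix

open Literature.MathematicalPhysics.QuantumFieldTheory.Balaban1983to89
open B5Prop11Plancherel B5Action121 B5Block118 B5LaplaceInverse B5LaplaceSpectral
open Prop7CentreHarmonicInterpolantFlat

variable {d : ℕ}

/-! ## §1 Symmetry of `Δ` and the double inverse -/

section AnyTorus

variable (N : Fin d → ℕ) [hN : ∀ μ, NeZero (N μ)]

/-- `Σ_z a(z)(Δe)(z) = Σ_z (Δa)(z)e(z)` — the lattice Laplacian is a symmetric bilinear kernel (translation bijections of the torus). [cite: Balaban1984PropagatorsI, (1.21) p.21] -/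
theorem sum_mul_LapS_mulVec_comm (c : ℂ) (a e : Tor N → ℂ) :
    ∑ z, a z * (LapS N c *ᵥ e) z = ∑ z, (LapS N c *ᵥ a) z * e z := by
  simp only [LapS_mulVec, Finset.mul_sum, Finset.sum_mul]
  rw [Finset.sum_comm]
  conv_rhs => rw [Finset.sum_comm]
  refine Finset.sum_congr rfl fun ν _ => ?_
  have h1 : ∑ z, a z * e (z + unitVec N ν) = ∑ z, a (z - unitVec N ν) * e z := by
    rw [← Equiv.sum_comp (Equiv.addRight (unitVec N ν)) (fun z => a (z - unitVec N ν) * e z)]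
    simp
  have h2 : ∑ z, a z * e (z - unitVec N ν) = ∑ z, a (z + unitVec N ν) * e z := by
    rw [← Equiv.sum_comp (Equiv.subRight (unitVec N ν)) (fun z => a (z + unitVec N ν) * e z)]
    simp
  have eL : ∀ z, a z * (conj c * c * (2 * e z - e (z + unitVec N ν) - e (z - unitVec N ν)))
      = conj c * c * (2 * (a z * e z)) - conj c * c * (a z * e (z + unitVec N ν)) - conj c * c * (a z * e (z - unitVec N ν)) := fun z => by ring
  have eR : ∀ z, conj c * c * (2 * a z - a (z + unitVec N ν) - a (z - unitVec N ν)) * e z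
      = conj c * c * (2 * (a z * e z)) - conj c * c * (a (z + unitVec N ν) * e z) - conj c * c * (a (z - unitVec N ν) * e z) := fun z => by ring
  simp only [eL, eR, Finset.sum_sub_distrib, ← Finset.mul_sum, h1, h2]
  ring

/-- `Σ_z a(z)(Δ²e)(z) = Σ_z (Δ²a)(z)e(z)`. [cite: Balaban1984PropagatorsI, (1.21) p.21] -/
theorem sum_mul_LapS_LapS_comm (c : ℂ) (a e : Tor N → ℂ) :
    ∑ z, a z * (LapS N c *ᵥ (LapS N c *ᵥ e)) z = ∑ z, (LapS N c *ᵥ (LapS N c *ᵥ a)) z * e z := by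
  rw [sum_mul_LapS_mulVec_comm, sum_mul_LapS_mulVec_comm]

/-- `Δ²(Δ⁻²f) = f` for a mean-zero `f` (`c ≠ 0`). [cite: Balaban1984PropagatorsI, Sect. C p.22] -/
theorem LapS_LapS_LapSinv_LapSinv_of_orth {c : ℂ} (hc : c ≠ 0) (f : Tor N → ℂ) (hf : ∑ x, f x = 0) :
    LapS N c *ᵥ (LapS N c *ᵥ (LapSinv N c *ᵥ (LapSinv N c *ᵥ f))) = f := by
  have h1 : LapS N c *ᵥ (LapSinv N c *ᵥ (LapSinv N c *ᵥ f)) = LapSinv N c *ᵥ f := by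
    rw [Matrix.mulVec_mulVec, Matrix.mulVec_mulVec, LapS_mul_LapSinv_mul_LapSinv]
  rw [h1, LapS_LapSinv_of_orth N hc f hf]

/-- `Σ_z (δ_x − δ_{y})(z) = 0`. [folklore] -/
theorem sum_delta_sub_delta (x y : Tor N) : ∑ z : Tor N, ((if z = x then (1 : ℂ) else 0) - (if z = y then (1 : ℂ) else 0)) = 0 := by
  rw [Finset.sum_sub_distrib, Finset.sum_ite_eq' Finset.univ x, Finset.sum_ite_eq' Finset.univ y]
  simp

end AnyTorus

/-! ## §2 ★★★ The pinned biharmonic Green matrix -/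

section TwoTori

variable (n : ℕ) [NeZero n] (M : Fin d → ℕ) [hM : ∀ μ, NeZero (M μ)]

/-- ★★★ **THE PINNED BIHARMONIC GREEN MATRIX EXISTS** (flat B5 model of the rows `hGrep`∕`hG0` of ✓ `…CentreHarmonicInterpKernel`): there is `G` on `T_η × T_η` vanishing in its second
argument at every centre `up y` and representing every function that vanishes on the centres through its bi-Laplacian: `e(x) = Σ_z G(x,z)·(Δ²e)(z)`.
[cite: Balaban1984PropagatorsI, Sect. C p.22; Balaban1985RegularSpaces, (1.14) p.78] -/
theorem exists_pinned_biharmonic_green (hn : 1 ≤ n) (y₀' : Tor M) :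
    ∃ G : Tor (fine n M) → Tor (fine n M) → ℂ,
      (∀ x y, G x (up n M y) = 0)
        ∧ ∀ e : Tor (fine n M) → ℂ, (∀ y, e (up n M y) = 0) →
            ∀ x, e x = ∑ z, G x z * (LapS (fine n M) (n : ℂ) *ᵥ (LapS (fine n M) (n : ℂ) *ᵥ e)) z := by
  classical
  have hc : (n : ℂ) ≠ 0 := by exact_mod_cast NeZero.ne n
  set y₀ : Tor (fine n M) := up n M y₀' with hy₀
  -- the free part `v_x = Δ⁻²(δ_x − δ_{y₀})`
  set src : Tor (fine n M) → Tor (fine n M) → ℂ := fun x z => (if z = x then (1 : ℂ) else 0) - (if z = y₀ then (1 : ℂ) else 0) with hsrc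
  set v : Tor (fine n M) → Tor (fine n M) → ℂ := fun x => LapSinv (fine n M) (n : ℂ) *ᵥ (LapSinv (fine n M) (n : ℂ) *ᵥ src x) with hv
  have hv2 : ∀ x, LapS (fine n M) (n : ℂ) *ᵥ (LapS (fine n M) (n : ℂ) *ᵥ v x) = src x :=
    fun x => LapS_LapS_LapSinv_LapSinv_of_orth (fine n M) hc (src x) (sum_delta_sub_delta (fine n M) x y₀)
  -- the pinned correction `u_x` (interpolant of `v_x|_centres`)
  have hu : ∀ x, ∃ u : Tor (fine n M) → ℂ, (∀ y, u (up n M y) = v x (up n M y))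
      ∧ ∀ z, (∀ y, z ≠ up n M y) → (LapS (fine n M) (n : ℂ) *ᵥ (LapS (fine n M) (n : ℂ) *ᵥ u)) z = 0 :=
    fun x => exists_pinned_biharmonic_interpolant n M hn (fun y => v x (up n M y))
  choose u hu1 hu2 using hu
  refine ⟨fun x z => v x z - u x z, fun x y => by simp [hu1 x y], ?_⟩
  intro e he x
  -- move `Δ²` onto `G(x,·)`
  have hsym : ∑ z, (v x z - u x z) * (LapS (fine n M) (n : ℂ) *ᵥ (LapS (fine n M) (n : ℂ) *ᵥ e)) z
      = ∑ z, (LapS (fine n M) (n : ℂ) *ᵥ (LapS (fine n M) (n : ℂ) *ᵥ (fun w => v x w - u x w))) z * e z :=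
    sum_mul_LapS_LapS_comm (fine n M) (n : ℂ) (fun w => v x w - u x w) e
  rw [hsym]
  -- `Δ²(v_x − u_x) = (δ_x − δ_{y₀}) − Δ²u_x`
  have hlin : (LapS (fine n M) (n : ℂ) *ᵥ (LapS (fine n M) (n : ℂ) *ᵥ (fun w => v x w - u x w)))
      = fun z => src x z - (LapS (fine n M) (n : ℂ) *ᵥ (LapS (fine n M) (n : ℂ) *ᵥ u x)) z := by
    have e1 : (fun w => v x w - u x w) = v x - u x := rfl
    rw [e1, Matrix.mulVec_sub, Matrix.mulVec_sub, hv2]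
    rfl
  rw [hlin]
  simp only [sub_mul, Finset.sum_sub_distrib]
  -- the `δ` part gives `e x − e y₀ = e x`; the `Δ²u_x` part lives on the centres where `e = 0`
  have hδ : ∑ z, src x z * e z = e x := by
    simp only [hsrc, sub_mul, Finset.sum_sub_distrib, ite_mul, one_mul, zero_mul, Finset.sum_ite_eq', Finset.mem_univ, if_true]
    rw [hy₀, he y₀', sub_zero]
  have hU : ∑ z, (LapS (fine n M) (n : ℂ) *ᵥ (LapS (fine n M) (n : ℂ) *ᵥ u x)) z * e z = 0 := by
    refine Finset.sum_eq_zero fun z _ => ?_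
    by_cases hz : ∃ y, z = up n M y
    · obtain ⟨y, rfl⟩ := hz
      rw [he y, mul_zero]
    · push Not at hz
      rw [hu2 x z hz, zero_mul]
  rw [hδ, hU, sub_zero]

end TwoTori

end Summit.QuantumFields.YangMills.Theorems.Prop7PinnedBiharmonicGreenMatrix
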